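import Summits.Ventures.DiscreteObjects.PP12.FlagTenConjunctC4

/-!
# The `f = 10` flag-cell orbit data: `φ` characterised by incidence (kernel; Step D helper for conjuncts 5, 6, 7, 9 of `IsFlagTenOrbitMatrix`)
Framing: lottery ticket; floor = certified bounds/negative ranges.

Cell pub-namedobj (venture DiscreteObjects), target (M), designs gen 13 (HOME FAMILY-FLAG7X §7c). Setting as in `FlagTenOrbitDataOfPlane`
(`σ³ = 1`, `f = 10` flag type, `u₀ ∋ c` a non-fixed line; the vertices are the points `x ≠ c` of `u₀`, `x ↦ orb3 x` its triangle).
* `vertex_eq_of_mem_orb3` — two vertices in the same point orbit are equal (`u₀` meets every orbit at most once);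
* `phiVertex_eq_iff` — for vertices `x' ≠ v`: `phiVertex x' = v` iff `x'` lies on a side of the triangle of `v`
  (a line of `orb3 (sideOf v)`);
* `card_sides_through` — the number of sides of the triangle of `v` through the vertex `x' ≠ v` is `[phiVertex x' = v]`.
These are the `[φ i' = i]` terms of the λ = 1 identities (R1), (C1), (R2), (C3) at plane level. No `sorry`, no new axioms.
-/

namespace Summit.Ventures.DiscreteObjects.PP12

open Configuration Finset
open scoped Classical

namespace Collineation

variable {P L : Type*} [Membership P L] [ProjectivePlane P L] [Fintype P] [Fintype L] (σ : Collineation P L)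

section Flag

variable {l : L} {c : P} (hl : σ.onLines l = l) (hc : σ.onPoints c = c) (hcl : c ∈ l)
  (hP : ∀ p : P, σ.onPoints p = p → p ∈ l) (hL : ∀ m : L, σ.onLines m = m → c ∈ m)
  (h12 : ProjectivePlane.order P L = 12)

omit [Fintype P] [Fintype L] in
include hc in
/-- Two points of a non-fixed line `u₀ ∋ c` in the same point orbit are equal. -/
theorem vertex_eq_of_mem_orb3 (hq : σ.onPoints ^ 3 = 1) {u₀ : L} (hcu₀ : c ∈ u₀) (hu₀ : σ.onLines u₀ ≠ u₀)
    {x' v : P} (hx'u : x' ∈ u₀) (hvu : v ∈ u₀) (h : x' ∈ orb3 σ.onPoints v) : x' = v := by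
  by_contra hne
  have h1 := σ.card_orb3_inter_cline_le_one hc hq hcu₀ hu₀ v
  have hsub : ({x', v} : Finset P) ⊆ (orb3 σ.onPoints v).filter fun q' => q' ∈ u₀ := by
    intro z hz
    simp only [mem_insert, mem_singleton] at hz
    rw [mem_filter]
    rcases hz with rfl | rfl
    · exact ⟨h, hx'u⟩
    · exact ⟨self_mem_orb3 _ _, hvu⟩
  have := card_le_card hsub
  rw [card_pair hne] at this
  omega

include hl hc hcl hP hL h12 in
/-- **`φ` by incidence** (`f = 10`): for vertices `x' ≠ v` on `u₀`, `phiVertex x' = v` iff `x'` lies on a side of the triangle of `v`. -/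
theorem phiVertex_eq_iff (hq : σ.onPoints ^ 3 = 1) (hf : fixedCard σ.onPoints = 10) {u₀ : L} (hcu₀ : c ∈ u₀) (hu₀ : σ.onLines u₀ ≠ u₀)
    {x' v : P} (hx'u : x' ∈ u₀) (hx'c : x' ≠ c) (hvu : v ∈ u₀) (hvc : v ≠ c) (hx'v : x' ≠ v) :
    σ.phiVertex l c u₀ x' = v ↔ ∃ g ∈ orb3 σ.onLines (σ.sideOf l v), x' ∈ g := by
  have hx'X := σ.exterior_of_mem_cline hL hcu₀ hu₀ hx'u hx'c
  have hvX := σ.exterior_of_mem_cline hL hcu₀ hu₀ hvu hvc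
  have hx'f : σ.onPoints x' ≠ x' := σ.not_fixed_of_exterior_flag hl hP hx'X
  have hvf : σ.onPoints v ≠ v := σ.not_fixed_of_exterior_flag hl hP hvX
  obtain ⟨hpu, hpc, ⟨Q, hQp, hQF, hσQF⟩, -⟩ := σ.phiVertex_spec hl hc hcl hP hL h12 hq hf hcu₀ hu₀ hx'X
  obtain ⟨hx'F, hF0, hF1, hF2⟩ := σ.foreignSide_spec hl hP h12 hq hf hx'X
  set p := σ.phiVertex l c u₀ x' with hp_def
  set F := σ.foreignSide l x' with hF_def
  have hpX := σ.exterior_of_mem_cline hL hcu₀ hu₀ hpu hpc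
  have hQX : ∀ m : L, σ.onLines m = m → Q ∉ m := σ.exterior_of_mem_orb3 hpX hQp
  have hQf : σ.onPoints Q ≠ Q := σ.not_fixed_of_exterior_flag hl hP hQX
  constructor
  · intro h
    -- F is a side of the triangle of p = v, and x' ∈ F
    have hQv : Q ∈ orb3 σ.onPoints v := by rw [← h]; exact hQp
    exact ⟨F, σ.mem_orb3_sideOf_of_side hq hvf hQv hQf hQF hσQF, hx'F⟩
  · rintro ⟨g, hg, hx'g⟩
    obtain ⟨R, hRv, hRg, hσRg⟩ := σ.side_of_mem_orb3_sideOf hq hvf hg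
    have hRX : ∀ m : L, σ.onLines m = m → R ∉ m := σ.exterior_of_mem_orb3 hvX hRv
    have hRf : σ.onPoints R ≠ R := σ.not_fixed_of_exterior_flag hl hP hRX
    obtain ⟨-, hg0⟩ := σ.side_no_fixed_point hRf hRX hRg hσRg
    have horbR : orb3 σ.onPoints R = orb3 σ.onPoints v := orb3_eq_of_mem σ.onPoints hq hRv
    -- x' is not a vertex of the triangle of v
    have hx'nv : x' ∉ orb3 σ.onPoints v := fun h' => hx'v (σ.vertex_eq_of_mem_orb3 hc hq hcu₀ hu₀ hx'u hvu h')
    -- hence σx' ∉ g and σ²x' ∉ g (else g would be a side of the triangle of x' too)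
    have h3 := apply_three σ.onPoints hq x'
    have hσx'g : σ.onPoints x' ∉ g := by
      intro h'
      have := σ.side_unique hRX hRg hσRg hx'g h'
      exact hx'nv (by rw [this]; rw [← horbR]; exact self_mem_orb3 _ _)
    have hσ2x'g : σ.onPoints (σ.onPoints x') ∉ g := by
      intro h'
      have e2 := σ.side_unique hRX hRg hσRg h' (by rw [h3]; exact hx'g)
      apply hx'nv
      rw [← horbR, ← e2]
      exact (mem_orb3 _ _ _).2 (Or.inr (Or.inl h3.symm))
    -- so g is THE foreign side of x'
    obtain ⟨F', -, huniq⟩ := σ.existsUnique_foreign_side hl hP h12 hq hf hx'X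
    have hgF : g = F := (huniq g ⟨hx'g, hg0, hσx'g, hσ2x'g⟩).trans (huniq F ⟨hx'F, hF0, hF1, hF2⟩).symm
    -- the owner of F: Q ∈ orb3 p with Q, σQ ∈ F = g; a line is a side of one triangle only
    rw [← hgF] at hQF hσQF
    have hQR : Q = R := σ.side_unique hRX hRg hσRg hQF hσQF
    have hpv : p ∈ orb3 σ.onPoints v := by
      rw [← horbR, ← hQR, orb3_eq_of_mem σ.onPoints hq hQp]; exact self_mem_orb3 _ _
    exact σ.vertex_eq_of_mem_orb3 hc hq hcu₀ hu₀ hpu hvu hpv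

include hl hc hcl hP hL h12 in
/-- **At most one side, and exactly `[φ x' = v]` sides, of the triangle of `v` pass through the vertex `x' ≠ v`** (`f = 10`). -/
theorem card_sides_through (hq : σ.onPoints ^ 3 = 1) (hf : fixedCard σ.onPoints = 10) {u₀ : L} (hcu₀ : c ∈ u₀) (hu₀ : σ.onLines u₀ ≠ u₀)
    {x' v : P} (hx'u : x' ∈ u₀) (hx'c : x' ≠ c) (hvu : v ∈ u₀) (hvc : v ≠ c) (hx'v : x' ≠ v) :
    ((orb3 σ.onLines (σ.sideOf l v)).filter fun g => x' ∈ g).card = if σ.phiVertex l c u₀ x' = v then 1 else 0 := by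
  have hqL : σ.onLines ^ 3 = 1 := σ.onLines_pow_eq_one hq
  have hx'X := σ.exterior_of_mem_cline hL hcu₀ hu₀ hx'u hx'c
  have hvX := σ.exterior_of_mem_cline hL hcu₀ hu₀ hvu hvc
  have hvf : σ.onPoints v ≠ v := σ.not_fixed_of_exterior_flag hl hP hvX
  have hx'nv : x' ∉ orb3 σ.onPoints v := fun h' => hx'v (σ.vertex_eq_of_mem_orb3 hc hq hcu₀ hu₀ hx'u hvu h')
  set S := (orb3 σ.onLines (σ.sideOf l v)).filter fun g => x' ∈ g with hS
  -- at most one side through x': two sides g ≠ g' through x' meet in a vertex of the triangle of v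
  have hle : S.card ≤ 1 := by
    rw [card_le_one]
    intro g hg g' hg'
    rw [hS, mem_filter] at hg hg'
    by_contra hne
    obtain ⟨R, hRv, hRg, hσRg⟩ := σ.side_of_mem_orb3_sideOf hq hvf hg.1
    obtain ⟨R', hR'v, hR'g', hσR'g'⟩ := σ.side_of_mem_orb3_sideOf hq hvf hg'.1
    have hRX : ∀ m : L, σ.onLines m = m → R ∉ m := σ.exterior_of_mem_orb3 hvX hRv
    have hRf : σ.onPoints R ≠ R := σ.not_fixed_of_exterior_flag hl hP hRX
    have h3 := apply_three σ.onPoints hq R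
    have horbR : orb3 σ.onPoints R = orb3 σ.onPoints v := orb3_eq_of_mem σ.onPoints hq hRv
    have hR'R : R' ∈ orb3 σ.onPoints R := by rw [horbR]; exact hR'v
    -- two distinct lines share at most one point: x' is the common point, and some vertex is common too
    have two : ∀ {z : P}, z ∈ g → z ∈ g' → z = x' := fun {z} hz hz' => by
      by_contra hzx
      exact hne ((Nondegenerate.eq_or_eq hz hg.2 hz' hg'.2).resolve_left hzx)
    have memv : ∀ {z : P}, z ∈ orb3 σ.onPoints R → z ∈ g → z ∈ g' → False := fun {z} hz hzg hzg' =>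
      hx'nv (by rw [← horbR, ← two hzg hzg']; exact hz)
    have hσR : σ.onPoints R ∈ orb3 σ.onPoints R := (mem_orb3 _ _ _).2 (Or.inr (Or.inl rfl))
    have hσ2R : σ.onPoints (σ.onPoints R) ∈ orb3 σ.onPoints R := (mem_orb3 _ _ _).2 (Or.inr (Or.inr rfl))
    rw [mem_orb3] at hR'R
    rcases hR'R with e | e | e
    · rw [e] at hR'g'; exact memv (self_mem_orb3 _ _) hRg hR'g'
    · rw [e] at hR'g'; exact memv hσR hσRg hR'g'
    · rw [e, h3] at hσR'g'; exact memv (self_mem_orb3 _ _) hRg hσR'g'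
  by_cases h : σ.phiVertex l c u₀ x' = v
  · rw [if_pos h]
    obtain ⟨g, hg, hx'g⟩ := (σ.phiVertex_eq_iff hl hc hcl hP hL h12 hq hf hcu₀ hu₀ hx'u hx'c hvu hvc hx'v).1 h
    have h1 : 1 ≤ S.card := card_pos.2 ⟨g, mem_filter.2 ⟨hg, hx'g⟩⟩
    omega
  · rw [if_neg h, card_eq_zero, hS, filter_eq_empty_iff]
    intro g hg hx'g
    exact h ((σ.phiVertex_eq_iff hl hc hcl hP hL h12 hq hf hcu₀ hu₀ hx'u hx'c hvu hvc hx'v).2 ⟨g, hg, hx'g⟩)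

end Flag

end Collineation

end Summit.Ventures.DiscreteObjects.PP12
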